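import Summits.BirchSwinnertonDyer.BirchSwinnertonDyer.Theorems.ResidualThetaTransportAtTwoSignedMuVanishingAtTwoPlusMultOneOldFamilyEngine
import Summits.BirchSwinnertonDyer.BirchSwinnertonDyer.Theorems.ResidualThetaTransportAtTwoSignedMuVanishingAtTwoPlusMultOneCongruence
import HarnessLib

/-!
# Route `ResidualThetaTransportAtTwo`, crux Kμ⁺ `SignedMuVanishingAtTwoPlus` (stmt-BirchSwinnertonDyer-20689), line
# `birth`, stub `stub_flatMuZeroAtTwo`: the old family for the level pattern `N_W = N₀ · ℓ · q` with `ℓ ∣ N₀` (the anchor is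
# multiplicative at `ℓ`, `W` is additive at `ℓ`) and ONE multiplicative level-raising prime `q ∤ N₀`, CONSTRUCTED with the
# engine — `S = {1, q, ℓ, ℓq}`, `H = D₁ + D_q + D_ℓ + D_{ℓq}`

Cell `bsd-wall`, width seat `bsd-wall-rtt-p4-w2` (g4). THEOREMS ONLY; helper `--supports` the crux; closes nothing. BSD is not proved
by this. Sibling of `…MultOneOldFamilyPrime` (`N₀q`), `…MultOneOldFamilyPrimeSq` (`N₀qℓ²`, `ℓ ∤ N₀`), `…MultOneOldFamilyTwoPrimes`
(`N₀q₁q₂`). NEW PHENOMENON at `ℓ ∣ N₀`: `U_ℓ H = (a_ℓ(g) + ℓ)(D₁ + D_q)` while `U_ℓ f = 0` (`W` additive at `ℓ`), so the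
`U_ℓ`-bookkeeping holds mod `2` iff `a_ℓ(g)` is ODD — the anchor's eigenvalue at `ℓ` is NOT congruent to `a_ℓ(W) = 0`; the
dictionary asks for `a_ℓ(g)` odd instead (automatic when the anchor is multiplicative at `ℓ`).

## What is proved
* `heckeT_q_oldFamily_primePow`, `heckeT_l_oldFamily_primePow`, `heckeT_oldFamily_primePow_of_dvd_level`: `T_q H =
  (a_q(g) + q)(D₁ + D_ℓ) − (D_q + D_{ℓq})`, `T_ℓ H = (a_ℓ(g) + ℓ)(D₁ + D_q)`, and `T_p H = a_p(g) H` for `p ∣ N₀`, `p ≠ ℓ`.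
* `flatAtTwo_of_namedFacts_of_primePow_level`: FLAT at `(W, f)` on the habitat⁺ with `N_W = N₀ ℓ q` from the four named facts, a
  congruent rational newform `g` of level `N₀` with `a_q(g)` even, `A q` odd, `a_ℓ(g)` ODD, `A ℓ` even, `A p ≡ a_p(g)` for
  `p ∉ {q, ℓ}`, and ONE odd doubled plus symbol of `g`; `flatAtTwo_turnkey_primePow_level`: the per-class turnkey with `W[2] ≃+ A'[2]`.

References: [AtkinLehner1970] Lemma 15; [DiamondShurman2005] §5.7, Prop. 5.8.5; [Buzzard2000LevelLoweringModTwo] Prop. 2.4;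
[DarmonDiamondTaylor1995] Lemma 1.38; [SerreInventiones1972] Prop. 12; [Mazur1978]; [EmertonPollackWeston2006] §4.4.
-/

set_option autoImplicit false
set_option linter.dupNamespace false

noncomputable section

open scoped Classical MatrixGroups ModularForm

open CongruenceSubgroup Field WeierstrassCurve Literature.NumberTheory.EllipticCurves
  Literature.NumberTheory.EllipticCurves.ModularForms Literature.NumberTheory.EllipticCurves.Rank1Residual
  Literature.NumberTheory.IwasawaTheory Summit.BirchSwinnertonDyer.Rank1Residual.Supersingular
  Summit.BirchSwinnertonDyer.BirchSwinnertonDyer.Theses.ResidualThetaTransportAtTwo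

namespace Summit.BirchSwinnertonDyer.BirchSwinnertonDyer.Theorems.SignedMuAtTwo

namespace MultOneDictionary

/-! ## §1. `T_p` on `H = D₁ + D_q + D_ℓ + D_{ℓq}` -/

section Hecke

variable {N₀ N : ℕ} [NeZero N₀] [NeZero N] {q ℓ : ℕ} (hq : q.Prime) (hℓ : ℓ.Prime) (hqℓ : q ≠ ℓ)
  (hqN₀ : ¬ q ∣ N₀) (hℓN₀ : ℓ ∣ N₀) (hN : N₀ * (ℓ * q) = N) (g : CuspForm (Gamma0 N₀) 2) (hg : IsNewform0 g)

include hq hℓ hqℓ hqN₀ hN hg in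
/-- **`T_q` on the old family**: `T_q (D₁ + D_q + D_ℓ + D_{ℓq}) = (a_q(g) + q)(D₁ + D_ℓ) − (D_q + D_{ℓq})`.
[cite: DiamondShurman2005, Prop. 5.2.2 (a), §5.7, Prop. 5.8.5] -/
theorem heckeT_q_oldFamily_primePow [NeZero q] [NeZero ℓ] [NeZero (ℓ * q)] :
    heckeT (Gamma0 N) 2 q (degeneracyMap0 N₀ N 1 2 g + degeneracyMap0 N₀ N q 2 g + degeneracyMap0 N₀ N ℓ 2 g +
        degeneracyMap0 N₀ N (ℓ * q) 2 g) =
      (cuspCoeff g q + q) • (degeneracyMap0 N₀ N 1 2 g + degeneracyMap0 N₀ N ℓ 2 g) -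
        (degeneracyMap0 N₀ N q 2 g + degeneracyMap0 N₀ N (ℓ * q) 2 g) := by
  have h1 : N₀ * 1 ∣ N := ⟨ℓ * q, by rw [mul_one, hN]⟩
  have hq' : N₀ * q ∣ N := ⟨ℓ, by rw [← hN]; ring⟩
  have hℓ' : N₀ * ℓ ∣ N := ⟨q, by rw [← hN]; ring⟩
  have hℓq : N₀ * (ℓ * q) ∣ N := ⟨1, by rw [← hN]; ring⟩
  have hqN : q ∣ N := ⟨N₀ * ℓ, by rw [← hN]; ring⟩
  have hqℓ' : ¬ q ∣ ℓ := fun h ↦ hqℓ ((Nat.prime_dvd_prime_iff_eq hq hℓ).mp h)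
  rw [map_add, map_add, map_add,
    heckeT_D_of_not_dvd (N := N) hg hq hqN hqN₀ (t := 1) (tp := q) (by simp [hq.one_lt.ne']) (one_mul q).symm h1 hq',
    heckeT_D_of_dvd (N := N) g hq hqN (t := 1) (tp := q) (one_mul q).symm h1 hq',
    heckeT_D_of_not_dvd (N := N) hg hq hqN hqN₀ (t := ℓ) (tp := ℓ * q) hqℓ' rfl hℓ' hℓq,
    heckeT_D_of_dvd (N := N) g hq hqN (t := ℓ) (tp := ℓ * q) rfl hℓ' hℓq]
  module

include hq hℓ hqℓ hℓN₀ hN hg in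
/-- **`T_ℓ` on the old family for `ℓ ∣ N₀`**: `T_ℓ (D₁ + D_q + D_ℓ + D_{ℓq}) = (a_ℓ(g) + ℓ)(D₁ + D_q)` (`T_ℓ D_t = a_ℓ(g) D_t` for
`ℓ ∤ t` since `g` is `U_ℓ`-eigen at level `N₀`; `T_ℓ D_{tℓ} = ℓ D_t`). [cite: DiamondShurman2005, Prop. 5.2.2 (a), §5.7, Prop. 5.8.5] -/
theorem heckeT_l_oldFamily_primePow [NeZero q] [NeZero ℓ] [NeZero (ℓ * q)] :
    heckeT (Gamma0 N) 2 ℓ (degeneracyMap0 N₀ N 1 2 g + degeneracyMap0 N₀ N q 2 g + degeneracyMap0 N₀ N ℓ 2 g +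
        degeneracyMap0 N₀ N (ℓ * q) 2 g) =
      (cuspCoeff g ℓ + ℓ) • (degeneracyMap0 N₀ N 1 2 g + degeneracyMap0 N₀ N q 2 g) := by
  have h1 : N₀ * 1 ∣ N := ⟨ℓ * q, by rw [mul_one, hN]⟩
  have hq' : N₀ * q ∣ N := ⟨ℓ, by rw [← hN]; ring⟩
  have hℓ' : N₀ * ℓ ∣ N := ⟨q, by rw [← hN]; ring⟩
  have hℓq : N₀ * (ℓ * q) ∣ N := ⟨1, by rw [← hN]; ring⟩
  have hℓN : ℓ ∣ N := ⟨N₀ * q, by rw [← hN]; ring⟩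
  have hℓq' : ¬ ℓ ∣ q := fun h ↦ hqℓ ((Nat.prime_dvd_prime_iff_eq hℓ hq).mp h).symm
  have hℓ1 : ¬ ℓ ∣ 1 := by simp [hℓ.one_lt.ne']
  rw [map_add, map_add, map_add, heckeT_D_of_dvd_level (N := N) hg hℓ hℓN₀ hℓ1 h1,
    heckeT_D_of_dvd_level (N := N) hg hℓ hℓN₀ hℓq' hq',
    heckeT_D_of_dvd (N := N) g hℓ hℓN (t := 1) (tp := ℓ) (one_mul ℓ).symm h1 hℓ',
    heckeT_D_of_dvd (N := N) g hℓ hℓN (t := q) (tp := ℓ * q) (mul_comm ℓ q) hq' hℓq]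
  module

include hq hℓ hqN₀ hN hg in
/-- **`T_p` on the old family for `p ∣ N₀`, `p ≠ ℓ`**: `T_p H = a_p(g) H`. [cite: DiamondShurman2005, Prop. 5.2.2 (a), §5.7] -/
theorem heckeT_oldFamily_primePow_of_dvd_level [NeZero q] [NeZero ℓ] [NeZero (ℓ * q)] {p : ℕ} (hp : p.Prime)
    (hpN₀ : p ∣ N₀) (hpℓ : p ≠ ℓ) :
    (haveI : NeZero p := ⟨hp.ne_zero⟩; heckeT (Gamma0 N) 2 p (degeneracyMap0 N₀ N 1 2 g + degeneracyMap0 N₀ N q 2 g +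
        degeneracyMap0 N₀ N ℓ 2 g + degeneracyMap0 N₀ N (ℓ * q) 2 g)) =
      cuspCoeff g p • (degeneracyMap0 N₀ N 1 2 g + degeneracyMap0 N₀ N q 2 g + degeneracyMap0 N₀ N ℓ 2 g +
        degeneracyMap0 N₀ N (ℓ * q) 2 g) := by
  haveI : NeZero p := ⟨hp.ne_zero⟩
  have h1 : N₀ * 1 ∣ N := ⟨ℓ * q, by rw [mul_one, hN]⟩
  have hq' : N₀ * q ∣ N := ⟨ℓ, by rw [← hN]; ring⟩
  have hℓ' : N₀ * ℓ ∣ N := ⟨q, by rw [← hN]; ring⟩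
  have hℓq : N₀ * (ℓ * q) ∣ N := ⟨1, by rw [← hN]; ring⟩
  have hpq : ¬ p ∣ q := fun h ↦ hqN₀ (((Nat.prime_dvd_prime_iff_eq hp hq).mp h) ▸ hpN₀)
  have hpℓ' : ¬ p ∣ ℓ := fun h ↦ hpℓ ((Nat.prime_dvd_prime_iff_eq hp hℓ).mp h)
  have hp1 : ¬ p ∣ 1 := by simp [hp.one_lt.ne']
  have hpℓq : ¬ p ∣ ℓ * q := fun h ↦ ((Nat.Prime.dvd_mul hp).mp h).elim hpℓ' hpq
  rw [map_add, map_add, map_add, heckeT_D_of_dvd_level (N := N) hg hp hpN₀ hp1 h1,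
    heckeT_D_of_dvd_level (N := N) hg hp hpN₀ hpq hq', heckeT_D_of_dvd_level (N := N) hg hp hpN₀ hpℓ' hℓ',
    heckeT_D_of_dvd_level (N := N) hg hp hpN₀ hpℓq hℓq, smul_add, smul_add, smul_add]

end Hecke

/-! ## §2. FLAT on the habitat⁺ for `N_W = N₀ · ℓ · q`, `ℓ ∣ N₀` -/

section Habitat

variable {W : WeierstrassCurve ℚ} [W.IsElliptic] [W.IsGloballyMinimal]

/-- **FLAT at `(W, f)` for `N_W = N₀ · ℓ · q` with `ℓ ∣ N₀`, old family constructed.** `W/ℚ` globally minimal, good supersingular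
at `2`, `a₂(W) = 0`, `Δ_W < 0`, newform `f` (eigenvalues `A p`); `N_W = N₀ ℓ q` with primes `ℓ ∣ N₀`, `q ∤ N₀`; `g` a normalised
newform of level `N₀` with rational coefficients and eigenvalues `B p`; parities `B q` even, `A q` odd, `B ℓ` ODD, `A ℓ` even;
`A p ≡ B p (mod 2)` for every prime `p ∉ {q, ℓ}`; ONE odd `2([b/4^k]⁺_g − [0]⁺_g)`; the four named facts. THEN `2 ∤ L♭` for every
Pollack pair of `f` at `2`. [cite: Buzzard2000LevelLoweringModTwo, Prop. 2.4] [cite: DarmonDiamondTaylor1995, §1.6 Lemma 1.38]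
[cite: SerreInventiones1972, §1.11 Prop. 12] [cite: Mazur1978, Thm. 1] [cite: EmertonPollackWeston2006, §4.4]
[cite: DiamondShurman2005, §5.7, Prop. 5.8.5] -/
theorem flatAtTwo_of_namedFacts_of_primePow_level (hBuz : buzzard2000_multiplicityOne_gamma0)
    (hSe : serre1972_supersingular_decompositionSubgroup_image) (hSD : heckeSelfDual_torsionBy_J0)
    (hMK : mazurKenku_exists_cyclic_isogeny)
    (hss : GoodSS W 2) (ha : W.frobeniusTrace 2 = 0) (hΔ : W.Δ < 0) [NeZero (W.conductorNorm ℤ)]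
    {f : CuspForm (Gamma0 (W.conductorNorm ℤ)) 2} (hf : IsNewformOf W f)
    (A : ℕ → ℤ) (hA : ∀ p : ℕ, p.Prime → cuspCoeff f p = (A p : ℂ))
    {N₀ q ℓ : ℕ} [NeZero N₀] (hq : q.Prime) (hℓ : ℓ.Prime) (hqℓ : q ≠ ℓ) (hqN₀ : ¬ q ∣ N₀) (hℓN₀ : ℓ ∣ N₀)
    (hN : N₀ * (ℓ * q) = W.conductorNorm ℤ)
    (g : CuspForm (Gamma0 N₀) 2) (hg : IsNewform0 g) (hQg : coeffField g = ⊥)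
    (B : ℕ → ℤ) (hB : ∀ p : ℕ, p.Prime → cuspCoeff g p = (B p : ℂ))
    (hBq : Even (B q)) (hAq : Odd (A q)) (hBℓ : Odd (B ℓ)) (hAℓ : Even (A ℓ))
    (hcongr : ∀ p : ℕ, p.Prime → p ≠ q → p ≠ ℓ → ((A p : ℤ) : ZMod 2) = ((B p : ℤ) : ZMod 2))
    (hres : ∃ k : ℕ, 1 ≤ k ∧ ∃ b : ℤ, Odd b ∧ ∃ m : ℤ, Odd m ∧
      ratPlusSymbol g ((b : ℚ) / 4 ^ k) = ratPlusSymbol g 0 + (m : ℚ) / 2) :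
    ∀ Lplus Lminus : IwasawaAlgebra 2, IsPollackPair f 2 Lplus Lminus → ¬ PowerSeries.C (2 : ℤ_[2]) ∣ Lminus := by
  haveI : NeZero q := ⟨hq.ne_zero⟩
  haveI : NeZero ℓ := ⟨hℓ.ne_zero⟩
  haveI : NeZero (ℓ * q) := ⟨mul_ne_zero hℓ.ne_zero hq.ne_zero⟩
  have h2N : ¬ 2 ∣ W.conductorNorm ℤ := by
    rw [W.dvd_conductorNorm_iff_not_hasGoodReductionAtPrime 2, not_not]
    exact hss.1
  have hNdvd : ∀ {m : ℕ}, m ∣ ℓ * q → N₀ * m ∣ W.conductorNorm ℤ := fun {m} hm ↦ by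
    rw [← hN]; exact Nat.mul_dvd_mul_left N₀ hm
  have h2N₀ : ¬ 2 ∣ N₀ := fun h ↦ h2N (h.trans ⟨ℓ * q, hN.symm⟩)
  have hqodd : Odd q := hq.odd_of_ne_two (by rintro rfl; exact h2N ((dvd_mul_left 2 N₀).trans (hNdvd (dvd_mul_left 2 _))))
  have hℓodd : Odd ℓ := hℓ.odd_of_ne_two (by rintro rfl; exact h2N₀ hℓN₀)
  have h1 : N₀ * 1 ∣ W.conductorNorm ℤ := hNdvd (one_dvd _)
  have hq' : N₀ * q ∣ W.conductorNorm ℤ := hNdvd (dvd_mul_left q _)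
  have hℓ' : N₀ * ℓ ∣ W.conductorNorm ℤ := hNdvd (dvd_mul_right ℓ _)
  have hℓq : N₀ * (ℓ * q) ∣ W.conductorNorm ℤ := hNdvd dvd_rfl
  have hΩg : plusPeriod g ≠ 0 := (IsNewform0.plusPeriod_pos_holds hg hQg).ne'
  have hA2 : A 2 = 0 := by
    have := hA 2 Nat.prime_two
    rw [hf.2 2, W.LFunction_apply_prime_eq_frobeniusTrace 2 hss.1, ha] at this
    exact_mod_cast this.symm
  have haev : Even (B 2) := by
    have h2q : (2 : ℕ) ≠ q := by rintro rfl; exact (Nat.not_even_iff_odd.mpr hqodd) even_two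
    have h2ℓ : (2 : ℕ) ≠ ℓ := by rintro rfl; exact (Nat.not_even_iff_odd.mpr hℓodd) even_two
    have h := hcongr 2 Nat.prime_two h2q h2ℓ
    rw [hA2, Int.cast_zero] at h
    exact even_iff_two_dvd.mpr ((ZMod.intCast_zmod_eq_zero_iff_dvd _ 2).mp h.symm)
  let H : CuspForm (Gamma0 (W.conductorNorm ℤ)) 2 := degeneracyMap0 N₀ (W.conductorNorm ℤ) 1 2 g +
    degeneracyMap0 N₀ (W.conductorNorm ℤ) q 2 g + degeneracyMap0 N₀ (W.conductorNorm ℤ) ℓ 2 g +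
    degeneracyMap0 N₀ (W.conductorNorm ℤ) (ℓ * q) 2 g
  have hHdef : H = degeneracyMap0 N₀ (W.conductorNorm ℤ) 1 2 g + degeneracyMap0 N₀ (W.conductorNorm ℤ) q 2 g +
      degeneracyMap0 N₀ (W.conductorNorm ℤ) ℓ 2 g + degeneracyMap0 N₀ (W.conductorNorm ℤ) (ℓ * q) 2 g := rfl
  have hHint : ∀ γ, ∃ m : ℤ, (cuspSymbol H γ).re = m * (plusPeriod g / 2) :=
    integral_add g (integral_add g (integral_add g (integral_degeneracyMap0 g hΩg h1) (integral_degeneracyMap0 g hΩg hq'))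
      (integral_degeneracyMap0 g hΩg hℓ')) (integral_degeneracyMap0 g hΩg hℓq)
  let δ : ℕ → (Gamma0 (W.conductorNorm ℤ) →* Gamma0 N₀) := fun t ↦
    if t = q then Gamma0.degeneracyConj N₀ _ q hq'
    else if t = ℓ then Gamma0.degeneracyConj N₀ _ ℓ hℓ'
    else if t = ℓ * q then Gamma0.degeneracyConj N₀ _ (ℓ * q) hℓq
    else Gamma0.degeneracyConj N₀ _ 1 h1
  have hq1 : q ≠ 1 := hq.one_lt.ne'
  have hℓ1 : ℓ ≠ 1 := hℓ.one_lt.ne'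
  have hℓq1 : ℓ * q ≠ 1 := fun h ↦ hℓ1 (Nat.eq_one_of_mul_eq_one_right h)
  have hℓ_q : ℓ ≠ q := fun h ↦ hqℓ h.symm
  have hℓq_q : ℓ * q ≠ q := fun h ↦ by
    have h' : ℓ * q = 1 * q := by rw [h, one_mul]
    exact hℓ1 (Nat.eq_of_mul_eq_mul_right hq.pos h')
  have hℓq_ℓ : ℓ * q ≠ ℓ := fun h ↦ by
    have h' : ℓ * q = ℓ * 1 := by rw [h, mul_one]
    exact hq1 (Nat.eq_of_mul_eq_mul_left hℓ.pos h')
  have hδ1 : δ 1 = Gamma0.degeneracyConj N₀ _ 1 h1 := by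
    simp only [δ, if_neg hq1.symm, if_neg hℓ1.symm, if_neg hℓq1.symm]
  have hδq : δ q = Gamma0.degeneracyConj N₀ _ q hq' := by simp only [δ, if_pos rfl]
  have hδℓ : δ ℓ = Gamma0.degeneracyConj N₀ _ ℓ hℓ' := by simp [δ, hℓ_q]
  have hδℓq : δ (ℓ * q) = Gamma0.degeneracyConj N₀ _ (ℓ * q) hℓq := by simp [δ, hℓq_q, hℓq_ℓ]
  have hHsym : ∀ γ : Gamma0 (W.conductorNorm ℤ), cuspSymbol H γ = ∑ t ∈ ({1, q, ℓ, ℓ * q} : Finset ℕ), cuspSymbol g (δ t γ) := by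
    intro γ
    rw [Finset.sum_insert (by simp [hq1.symm, hℓ1.symm, hℓq1.symm]), Finset.sum_insert (by simp [hqℓ, hℓq_q.symm]),
      Finset.sum_pair hℓq_ℓ.symm, hδ1, hδq, hδℓ, hδℓq, hHdef, cuspSymbol_add, cuspSymbol_add, cuspSymbol_add,
      cuspSymbol_degeneracyMap0 h1, cuspSymbol_degeneracyMap0 hq', cuspSymbol_degeneracyMap0 hℓ', cuspSymbol_degeneracyMap0 hℓq]
    ring
  refine flatAtTwo_of_namedFacts hBuz hSe hSD hMK hss ha hΔ hf A hA g hg hQg h2N₀ B hB haev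
    (fun p hp hpN ↦ hcongr p hp (by intro h; subst h; exact hpN ((dvd_mul_left _ N₀).trans hq'))
      (by intro h; subst h; exact hpN ((dvd_mul_left _ N₀).trans hℓ')))
    {1, q, ℓ, ℓ * q} ⟨1, by simp⟩ (fun t ht ↦ ?_) δ (fun t ht γ ↦ ?_) (fun t ht γ ↦ ?_) (fun t ht γ ↦ ?_)
    (fun t ht γ ↦ ?_) (fun t ht γ ↦ ?_) H hHsym (fun p hp hpN ↦ ?_) (fun p hp hpN γ σ hσ mσ mγ hmσ hmγ ↦ ?_) hres
  · simp only [Finset.mem_insert, Finset.mem_singleton] at ht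
    rcases ht with rfl | rfl | rfl | rfl
    exacts [odd_one, hqodd, hℓodd, hℓodd.mul hqodd]
  · simp only [Finset.mem_insert, Finset.mem_singleton] at ht
    rcases ht with rfl | rfl | rfl | rfl
    · rw [hδ1]; rfl
    · rw [hδq]; rfl
    · rw [hδℓ]; rfl
    · rw [hδℓq]; rfl
  · simp only [Finset.mem_insert, Finset.mem_singleton] at ht
    rcases ht with rfl | rfl | rfl | rfl
    · rw [hδ1]; exact Gamma0.degeneracyConjElt_apply_zero_one h1 γ
    · rw [hδq]; exact Gamma0.degeneracyConjElt_apply_zero_one hq' γ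
    · rw [hδℓ]; exact Gamma0.degeneracyConjElt_apply_zero_one hℓ' γ
    · rw [hδℓq]; exact Gamma0.degeneracyConjElt_apply_zero_one hℓq γ
  · simp only [Finset.mem_insert, Finset.mem_singleton] at ht
    rcases ht with rfl | rfl | rfl | rfl
    · rw [hδ1]; rfl
    · rw [hδq]; rfl
    · rw [hδℓ]; rfl
    · rw [hδℓq]; rfl
  · simp only [Finset.mem_insert, Finset.mem_singleton] at ht
    rcases ht with rfl | rfl | rfl | rfl
    · rw [hδ1]; rfl
    · rw [hδq]; rfl
    · rw [hδℓ]; rfl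
    · rw [hδℓq]; rfl
  · have hγ := γ.2
    rw [Gamma0_mem] at hγ
    have hNc : ((W.conductorNorm ℤ : ℕ) : ℤ) ∣ (γ : SL(2, ℤ)) 1 0 := (ZMod.intCast_zmod_eq_zero_iff_dvd _ _).mp hγ
    have key : ∀ {t : ℕ}, N₀ * t ∣ W.conductorNorm ℤ → (t : ℤ) ∣ (γ : SL(2, ℤ)) 1 0 := fun {t} h ↦
      (Int.natCast_dvd_natCast.mpr ((dvd_mul_left t N₀).trans h)).trans hNc
    simp only [Finset.mem_insert, Finset.mem_singleton] at ht
    rcases ht with rfl | rfl | rfl | rfl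
    exacts [key h1, key hq', key hℓ', key hℓq]
  · haveI : NeZero p := ⟨hp.ne_zero⟩
    rw [hHdef, map_add, map_add, map_add, heckeT_D_of_not_dvd_level' hg hp hpN h1, heckeT_D_of_not_dvd_level' hg hp hpN hq',
      heckeT_D_of_not_dvd_level' hg hp hpN hℓ', heckeT_D_of_not_dvd_level' hg hp hpN hℓq, hB p hp, ← smul_add, ← smul_add,
      ← smul_add]
  · haveI : NeZero p := ⟨hp.ne_zero⟩
    by_cases hpℓ : p = ℓ
    · -- `p = ℓ ∣ N₀`: `U_ℓ H = (B ℓ + ℓ)(D₁ + D_q)` with `B ℓ`, `ℓ` odd, and `A ℓ` even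
      subst hpℓ
      obtain ⟨b, hb⟩ := hBℓ
      obtain ⟨c, hc⟩ := hAℓ
      obtain ⟨r, hr⟩ := hℓodd
      refine hbad_of_two_smul g hΩg H
        (((b + r + 1 : ℤ) : ℂ) • (degeneracyMap0 N₀ (W.conductorNorm ℤ) 1 2 g + degeneracyMap0 N₀ (W.conductorNorm ℤ) q 2 g) +
          ((-c : ℤ) : ℂ) • H)
        (integral_add g (integral_zsmul g (integral_add g (integral_degeneracyMap0 g hΩg h1) (integral_degeneracyMap0 g hΩg hq')) _)
          (integral_zsmul g hHint _))
        (A p) ?_ γ σ hσ mσ mγ hmσ hmγ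
      rw [hHdef, heckeT_l_oldFamily_primePow hq hℓ hqℓ hℓN₀ hN g hg, hB p hp]
      have e1 : ((B p : ℤ) : ℂ) = 2 * (b : ℂ) + 1 := by rw [hb]; push_cast; ring
      have e2 : ((A p : ℤ) : ℂ) = 2 * (c : ℂ) := by rw [hc]; push_cast; ring
      have e3 : ((p : ℕ) : ℂ) = 2 * (r : ℂ) + 1 := by rw [hr]; push_cast; ring
      rw [e1, e2, e3]
      push_cast
      module
    have hpcases : p ∣ N₀ ∨ p = q := by
      rw [← hN] at hpN
      rcases (Nat.Prime.dvd_mul hp).mp hpN with h | h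
      · exact Or.inl h
      · rcases (Nat.Prime.dvd_mul hp).mp h with h | h
        · exact absurd ((Nat.prime_dvd_prime_iff_eq hp hℓ).mp h) hpℓ
        · exact Or.inr ((Nat.prime_dvd_prime_iff_eq hp hq).mp h)
    rcases hpcases with hpN₀ | rfl
    · have hpq : p ≠ q := by rintro rfl; exact hqN₀ hpN₀
      have h2 : (2 : ℤ) ∣ B p - A p := (ZMod.intCast_eq_intCast_iff_dvd_sub _ _ _).mp (hcongr p hp hpq hpℓ)
      obtain ⟨b, hb⟩ := h2
      refine hbad_of_two_smul g hΩg H ((b : ℂ) • H) (integral_zsmul g hHint b) (A p) ?_ γ σ hσ mσ mγ hmσ hmγ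
      rw [hHdef, heckeT_oldFamily_primePow_of_dvd_level hq hℓ hqN₀ hN g hg hp hpN₀ hpℓ, hB p hp, ← hHdef, smul_smul,
        ← add_smul]
      congr 1
      have : (B p : ℂ) = (A p : ℂ) + 2 * (b : ℂ) := by
        have h' : (B p : ℤ) = A p + 2 * b := by linarith
        exact_mod_cast h'
      rw [this]
    · obtain ⟨b, hb⟩ := hBq
      obtain ⟨c, hc⟩ := hAq
      obtain ⟨r, hr⟩ := hqodd
      refine hbad_of_two_smul g hΩg H
        (((b + r - c : ℤ) : ℂ) • (degeneracyMap0 N₀ (W.conductorNorm ℤ) 1 2 g + degeneracyMap0 N₀ (W.conductorNorm ℤ) ℓ 2 g) +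
          ((-c - 1 : ℤ) : ℂ) • (degeneracyMap0 N₀ (W.conductorNorm ℤ) p 2 g + degeneracyMap0 N₀ (W.conductorNorm ℤ) (ℓ * p) 2 g))
        (integral_add g (integral_zsmul g (integral_add g (integral_degeneracyMap0 g hΩg h1) (integral_degeneracyMap0 g hΩg hℓ')) _)
          (integral_zsmul g (integral_add g (integral_degeneracyMap0 g hΩg hq') (integral_degeneracyMap0 g hΩg hℓq)) _))
        (A p) ?_ γ σ hσ mσ mγ hmσ hmγ
      rw [hHdef, heckeT_q_oldFamily_primePow hq hℓ hqℓ hqN₀ hN g hg, hB p hp]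
      have e1 : ((B p : ℤ) : ℂ) = 2 * (b : ℂ) := by rw [hb]; push_cast; ring
      have e2 : ((A p : ℤ) : ℂ) = 2 * (c : ℂ) + 1 := by rw [hc]; push_cast; ring
      have e3 : ((p : ℕ) : ℂ) = 2 * (r : ℂ) + 1 := by rw [hr]; push_cast; ring
      rw [e1, e2, e3]
      push_cast
      module

/-- **Per-class turnkey, pattern `N_W = N₀ · ℓ · q`, `ℓ ∣ N₀`.** As `flatAtTwo_of_namedFacts_of_primePow_level`, with the
congruence `A p ≡ B p (mod 2)` at the good primes discharged from an equivariant `W[2] ≃+ A'[2]` for an anchor curve `A'` of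
conductor dividing `N_W` whose newform is `g` (`…MultOneCongruence.eigenvalue_congr_two_of_geomTorsion_equiv`); what remains
displayed is: `B 2` even, `B q` even, `A q` odd, `B ℓ` odd, `A ℓ` even, `A p ≡ B p` at the primes `p ∣ N₀`, `p ≠ ℓ`, and ONE odd
doubled plus symbol of `g`. [cite: Buzzard2000LevelLoweringModTwo, Prop. 2.4] [cite: DarmonDiamondTaylor1995, §1.6 Lemma 1.38]
[cite: SerreInventiones1972, §1.11 Prop. 12] [cite: Mazur1978, Thm. 1] [cite: DiamondShurman2005, §5.7, Prop. 5.8.5] -/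
theorem flatAtTwo_turnkey_primePow_level (hBuz : buzzard2000_multiplicityOne_gamma0)
    (hSe : serre1972_supersingular_decompositionSubgroup_image) (hSD : heckeSelfDual_torsionBy_J0)
    (hMK : mazurKenku_exists_cyclic_isogeny)
    (hss : GoodSS W 2) (ha : W.frobeniusTrace 2 = 0) (hΔ : W.Δ < 0) [NeZero (W.conductorNorm ℤ)]
    {f : CuspForm (Gamma0 (W.conductorNorm ℤ)) 2} (hf : IsNewformOf W f)
    (A : ℕ → ℤ) (hA : ∀ p : ℕ, p.Prime → cuspCoeff f p = (A p : ℂ))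
    (A' : WeierstrassCurve ℚ) [A'.IsElliptic] (hNA : A'.conductorNorm ℤ ∣ W.conductorNorm ℤ)
    (e : geomTorsion W (2 : ℕ) ≃+ geomTorsion A' (2 : ℕ))
    (he : ∀ (σ : absoluteGaloisGroup ℚ) (P : geomTorsion W (2 : ℕ)), e (σ • P) = σ • e P)
    {N₀ q ℓ : ℕ} [NeZero N₀] (hq : q.Prime) (hℓ : ℓ.Prime) (hqℓ : q ≠ ℓ) (hqN₀ : ¬ q ∣ N₀) (hℓN₀ : ℓ ∣ N₀)
    (hN : N₀ * (ℓ * q) = W.conductorNorm ℤ)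
    (g : CuspForm (Gamma0 N₀) 2) (hg : IsNewformOf A' g)
    (B : ℕ → ℤ) (hB : ∀ p : ℕ, p.Prime → cuspCoeff g p = (B p : ℂ)) (hB2 : Even (B 2))
    (hBq : Even (B q)) (hAq : Odd (A q)) (hBℓ : Odd (B ℓ)) (hAℓ : Even (A ℓ))
    (hcongr₀ : ∀ p : ℕ, p.Prime → p ∣ N₀ → p ≠ ℓ → ((A p : ℤ) : ZMod 2) = ((B p : ℤ) : ZMod 2))
    (hres : ∃ k : ℕ, 1 ≤ k ∧ ∃ b : ℤ, Odd b ∧ ∃ m : ℤ, Odd m ∧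
      ratPlusSymbol g ((b : ℚ) / 4 ^ k) = ratPlusSymbol g 0 + (m : ℚ) / 2) :
    ∀ Lplus Lminus : IwasawaAlgebra 2, IsPollackPair f 2 Lplus Lminus → ¬ PowerSeries.C (2 : ℤ_[2]) ∣ Lminus := by
  have hA2 : A 2 = 0 := by
    have := hA 2 Nat.prime_two
    rw [hf.2 2, W.LFunction_apply_prime_eq_frobeniusTrace 2 hss.1, ha] at this
    exact_mod_cast this.symm
  have hgood := eigenvalue_congr_two_of_geomTorsion_equiv W A' e he hNA hf hg A B hA hB (by rw [hA2]; exact Even.zero) hB2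
  refine flatAtTwo_of_namedFacts_of_primePow_level hBuz hSe hSD hMK hss ha hΔ hf A hA hq hℓ hqℓ hqN₀ hℓN₀ hN g hg.1
    hg.coeffField_eq_bot B hB hBq hAq hBℓ hAℓ (fun p hp hpq hpℓ ↦ ?_) hres
  by_cases hpN : p ∣ W.conductorNorm ℤ
  · rw [← hN] at hpN
    rcases (Nat.Prime.dvd_mul hp).mp hpN with h | h
    · exact hcongr₀ p hp h hpℓ
    · rcases (Nat.Prime.dvd_mul hp).mp h with h | h
      · exact absurd ((Nat.prime_dvd_prime_iff_eq hp hℓ).mp h) hpℓ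
      · exact absurd ((Nat.prime_dvd_prime_iff_eq hp hq).mp h) hpq
  · exact hgood p hp hpN

end Habitat

end MultOneDictionary

end Summit.BirchSwinnertonDyer.BirchSwinnertonDyer.Theorems.SignedMuAtTwo

end
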